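import Summits.KontsevichZagierPeriods.KontsevichZagierPeriods.Theorems.FurushoPentagonPentagonInKZ

/-!
# Crux `KernelModuloPeriodConjecture` (stmt-KontsevichZagierPeriods-15058) — line `MixedPentagonInKZ`,
F3 WITNESS (`Lines/MixedPentagonInKZ_special.lean`; forward-rung harvest, unit
`fwd-harvest-KontsevichZagierPeriods-01`, source seat `fwd-rung-KontsevichZagierPeriods-01`, 2026-08-17)

The rung family SPECIALISES TO THE PROVED FLOOR: `CycloPentagonInKZ 1` is closed by the seed
`Summit.KontsevichZagierPeriods.FurushoPentagon.PentagonInKZ.PentagonInKZ_of` (stmt-KontsevichZagierPeriods-11348)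
with `simpa`; the rung itself is `CycloPentagonInKZ 2 = MixedPentagonInKZ` (line file
`Lines/MixedPentagonInKZ.lean`: three registered stubs + `MixedPentagonInKZ_of`). Sorry-free.

The definitions below are BYTE-IDENTICAL copies of the line file's (and of the source seat's
`Sketch.lean`), kept in the sub-namespace `.Special` so that this witness module is self-contained and
never clashes with the line module if both are imported.
-/

noncomputable section

set_option linter.dupNamespace false

namespace Summit.KontsevichZagierPeriods.KontsevichZagierPeriods.Cruxes.KernelModuloPeriodConjecture.CycloPentagon.Special

open Literature.NumberTheory.Transcendental
open Summit.KontsevichZagierPeriods.KontsevichZagierPeriods.Theses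

/-- crux (rank 2) — **the level-2 mixed pentagon inside the KZ rules** (next rung above
`FurushoPentagon.PentagonInKZ`: one level lifted, `ℙ¹∖{0,1,∞}` ↦ `ℙ¹∖{0,±1,∞}`). For every
commutative `ℚ`-algebra `R`, every realisation `χ` of the rules (additive, killing `KZ.relations`,
multiplicative, unital), every `Z` pinned to the MZV simplex classes (so that `Φ_χ` below is the
floor's series verbatim) and every level-2 series `Ψ : R⟨⟨Fin 3⟩⟩` which is group-like, vanishes on
the divergent letters `0` (`dt/t`) and `1` (`dt/(t-1)`), and whose coefficient of every convergent word
`w` (nonempty, `head ≠ 1`, `last ≠ 0`; leftmost letter outermost) is `χ` of the simplex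
representation `[{1 > t₀ > ⋯ > t_{n-1} > 0}, ∏ᵢ (tᵢ - σ(wᵢ))⁻¹]`, `σ = (0, 1, -1)`: for every
`R`-algebra `A`, elements `e : Fin 8 → A` (↔ the lines `x=0, x=1, x=-1, y=0, y=1, y=-1, x=y, x=-y`)
with all products of `m+1` of them zero and satisfying Kohno's relations
`[e_i, Σ_{j ∈ S} e_j] = 0` (`i ∈ S`) for the nine affine multiple points
`S ∈ {(0,0)↦{0,3,6,7}, (1,1)↦{1,4,6}, (-1,-1)↦{2,5,6}, (1,-1)↦{1,5,7}, (-1,1)↦{2,4,7}, (0,1)↦{0,4},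
(0,-1)↦{0,5}, (1,0)↦{1,3}, (-1,0)↦{2,3}}` (= Enriquez's presentation of `𝔱⁰₄,₂` under
`e 0 ↦ t¹², e 3 ↦ t¹³, e 6 ↦ t(0)²³, e 7 ↦ t(1)²³, e 1 ↦ t(0)²⁴, e 2 ↦ t(1)²⁴, e 4 ↦ t(0)³⁴,
e 5 ↦ t(1)³⁴`), Enriquez's MIXED PENTAGON EQUATION `h^{1,2,34} h^{12,3,4} = g^{2,3,4} h^{1,23,4} h^{1,2,3}`
(Enriquez–Furusho 2012, Def. 3.3 (mixed pentagon-GRTM), insertion maps of §3) holds VERBATIM for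
`(g, h) = (Φ_χ, Ψ)`:
`Ψ(e 0, e 1 + e 6, e 2 + e 7) · Ψ(e 3 + e 6 + e 7, e 4, e 5)
   = Φ(e 6, e 4) · Ψ(e 0 + e 3 + e 6 + e 7, e 1 + e 4, e 2 + e 5) · Ψ(e 0, e 6, e 7)` in `A`
(`Φ(a,b) = NCSeries.subst₂ m Φ a b`, `Ψ(a,b,c) = NCSeries.evalTrunc m ![a,b,c] Ψ`).  Numerically
validated to weight 4 (folder numerics/, residual 9e-16 in the 1441-dimensional weight-4 quotient).
[cite: EnriquezFurusho2012, Def. 3.3]; [cite: Enriquez2007, §1]; [cite: Drinfeld1991, §2] -/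
def MixedPentagonInKZ : Prop :=
  ∀ (R : Type) [CommRing R] [Algebra ℚ R] (χ : KZ.FormalRep →+ R),
    (∀ c ∈ KZ.relations, χ c = 0) →
    (∀ a b : KZ.FormalRep, χ (a * b) = χ a * χ b) →
    (∃ u : KZ.FormalRep, χ u = 1) →
    ∀ Z : List ℕ → KZ.FormalRep,
      (∀ (u : List ℕ) (hu : MZV.IsAdmissible u),
        Z u = KZ.of (KZ.mzvRep u hu (KZ.mzvIntegrand_isSemialgebraicFunOn_holds u)
          (KZ.mzvIntegrand_integrableOn_holds u hu))) →
    ∀ Ψ : NCSeries (Fin 3) R,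
      NCSeries.IsGroupLike Ψ → Ψ [0] = 0 → Ψ [1] = 0 →
      (∀ w : List (Fin 3), w ≠ [] → w.head? ≠ some 1 → w.getLast? ≠ some 0 →
        ∃ r : KZ.IntegralRep w.length,
          r.domain = KZ.openOrderedSimplex w.length ∧
          Set.EqOn r.integrand
            (fun t => ∏ i : Fin w.length, (t i - (![(0 : ℝ), 1, -1] : Fin 3 → ℝ) (w.get i))⁻¹)
            r.domain ∧
          Ψ w = χ (KZ.of r)) →
      ∀ (A : Type) [Ring A] [Algebra R A] (e : Fin 8 → A) (m : ℕ),
        (∀ f : Fin (m + 1) → Fin 8, ((List.ofFn f).map e).prod = 0) →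
        (∀ S ∈ ([[0, 3, 6, 7], [1, 4, 6], [2, 5, 6], [1, 5, 7], [2, 4, 7], [0, 4], [0, 5], [1, 3],
            [2, 3]] : List (List (Fin 8))), ∀ i ∈ S, Commute (e i) (S.map e).sum) →
        NCSeries.evalTrunc m ![e 0, e 1 + e 6, e 2 + e 7] Ψ *
            NCSeries.evalTrunc m ![e 3 + e 6 + e 7, e 4, e 5] Ψ =
          NCSeries.subst₂ m
                (fun W : List Bool => (-1 : R) ^ (W.count true) *
                  (MZV.shuffleReg W).sum (fun v a => a • (if MZV.IsConvergentWord v then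
                    χ (Z (MZV.ofBinaryWord v)) else (0 : R))))
                (e 6) (e 4) *
              NCSeries.evalTrunc m ![e 0 + e 3 + e 6 + e 7, e 1 + e 4, e 2 + e 5] Ψ *
            NCSeries.evalTrunc m ![e 0, e 6, e 7] Ψ

/-- The graded family (LEVEL `N` of the cyclotomic pentagon inside the rules), typed for
`N ∈ {1, 2}`: level 1 is the floor `FurushoPentagon.PentagonInKZ` VERBATIM (the tree's level-1
objects — `Bool` words, `DrinfeldKohnoTrunc R (Fin 4)`, `MZV.shuffleReg` — are not syntactic
instances of the level-`N` interface; the interface form at `N = 1` is equivalent to the floor by the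
universal property of `U𝔞₄` and uniqueness of shuffle regularisation), level 2 is
`MixedPentagonInKZ`; levels `N ≥ 3` have complex poles `μ_N` and are not typed (the family is
`False` there, i.e. makes no claim). [cite: Enriquez2007, §1] -/
def CycloPentagonInKZ (N : ℕ) : Prop :=
  (N = 1 ∨ N = 2) ∧ (N = 1 → FurushoPentagon.PentagonInKZ) ∧ (N = 2 → MixedPentagonInKZ)

/-- Level 1 of the family is literally the floor. -/
theorem cycloPentagonInKZ_one_iff : CycloPentagonInKZ 1 ↔ FurushoPentagon.PentagonInKZ := by
  simp [CycloPentagonInKZ]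

/-- Level 2 of the family is the rung. -/
theorem cycloPentagonInKZ_two_iff : CycloPentagonInKZ 2 ↔ MixedPentagonInKZ := by
  simp [CycloPentagonInKZ]

/-! ## The witness -/

/-- **F3 witness**: level 1 of the family is the floor, proved by the seed. -/
example : CycloPentagonInKZ 1 := by
  simpa [CycloPentagonInKZ] using Summit.KontsevichZagierPeriods.FurushoPentagon.PentagonInKZ.PentagonInKZ_of

/-- (same, as a named theorem for the record) [folklore] -/
theorem cycloPentagonInKZ_one : CycloPentagonInKZ 1 :=
  ⟨Or.inl rfl, fun _ => Summit.KontsevichZagierPeriods.FurushoPentagon.PentagonInKZ.PentagonInKZ_of,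
    fun h => absurd h (by decide)⟩

/-- The floor is recovered from level 1 of the family (and conversely), by name. [folklore] -/
theorem pentagonInKZ_of_cycloPentagonInKZ_one (h : CycloPentagonInKZ 1) : FurushoPentagon.PentagonInKZ :=
  h.2.1 rfl

end Summit.KontsevichZagierPeriods.KontsevichZagierPeriods.Cruxes.KernelModuloPeriodConjecture.CycloPentagon.Special

end
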